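import Literature.NumberTheory.Automorphic.AdeleBaseChange
import Mathlib.NumberTheory.NumberField.Completion.FinitePlace
import Mathlib.RingTheory.RamificationInertia.Ramification
import Mathlib.RingTheory.RamificationInertia.Inertia
import HarnessLib

/-!
# The completion at a place of degree one: `F_v ≃ K_w` when `e(w|v) = f(w|v) = 1`

Sibling proof file of `Literature.NumberTheory.Automorphic.AdeleBaseChange` (D-0014 append
protocol; everything here is proved, no definitions). For an extension of number fields `K/F`
and a finite place `w` of `K` above the place `v` of `F` with ramification index
`e(w|v) = 1` and residue degree `f(w|v) = 1`, the local base-change map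
`F_v →+* K_w` (`Literature.NumberTheory.Automorphic.adicCompletionOfLiesOver`) is a ring
isomorphism mapping `𝒪_v` onto `𝒪_w` — the degree-one case `[K_w : F_v] = e f = 1` of the local
degree formula (Cassels–Fröhlich, Ch. II §10; Neukirch, *Algebraic Number Theory*, II (6.8) and
(8.?)), which Mathlib does not have at the pin. The proof given here is direct:

* **Algebra** (`exists_sub_algebraMap_mem_pow`): if `𝓞_F → 𝓞_K/w` is onto (`f = 1`) and
  `v𝓞_K ⊄ w²` (`e = 1`), then `𝓞_F + wⁿ = 𝓞_K` for every `n`, i.e. `𝓞_F` is `w`-adically dense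
  in `𝓞_K`: `w = v𝓞_K + w²` (the ideals between `w²` and `w` are `w`, `w²`), hence by induction
  `𝓞_K = 𝓞_F + wⁿ ⇒ v𝓞_K = v(𝓞_F + wⁿ) ⊆ 𝓞_F + w^{n+1}` and
  `wⁿ ⊆ v𝓞_K + w^{n+1} ⊆ 𝓞_F + w^{n+1}`.
* **Topology** (`surjective_adicCompletionOfLiesOver`): the image of `F_v` in `K_w` is an
  `F_v`-line, closed since finite-dimensional subspaces of the Hausdorff topological vector
  space `K_w` over the complete field `F_v` are closed (Mathlib
  `Submodule.closed_of_finiteDimensional`, the argument of its instance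
  `Module.Finite K_v L_w`); it contains the image of `𝓞_K` by the density above
  (`v_w(a - y) ≤ q^{-n}`), hence the image of `K = Frac 𝓞_K` (it is a subfield), which is dense.
* **Packaging** (`exists_ringEquiv_adicCompletion_of_ramificationIdx_eq_one_of_inertiaDeg_eq_one`):
  compatible ring isomorphisms `ψ : 𝒪_v ≃+* 𝒪_w`, `φ : F_v ≃+* K_w` extending `F → K`
  (`𝒪_v ↦ 𝒪_w` because `v_w ∘ φ = v_v`, `valued_adicCompletionOfLiesOver` with `e = 1`), in the
  hypothesis form of the transport lemmas for Weierstrass curves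
  (`WeierstrassCurve.localEulerFactor_map_ringEquiv`, `…localRootNumber_map_ringEquiv`).

The hypotheses are Mathlib's `w.asIdeal.ramificationIdx (𝓞 F) = 1` and
`w.asIdeal.inertiaDeg (𝓞 F) = 1` (T. Browning's 2026 definitions, equal to the classical
`ramificationIdx'`, `inertiaDeg'` for Dedekind domains).

## References

* J. W. S. Cassels, A. Fröhlich (eds.), *Algebraic Number Theory* (1967), Ch. II §10
  (`[L_w : K_v] = e(w|v) f(w|v)`). [CasselsFrohlichANT1967]
-/

noncomputable section

open IsDedekindDomain NumberField

namespace Literature.NumberTheory.Automorphic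

/-! ### Algebra: `𝓞_F` is `w`-adically dense in `𝓞_K` when `e = f = 1` -/

section Algebra

variable {A B : Type*} [CommRing A] [CommRing B] [IsDedekindDomain B] [Algebra A B]

/-- **`A + Pⁿ = B` when `A → B/P` is onto and `(P ∩ A)B ⊄ P²`.** Let `B` be a Dedekind domain
over `A`, `P` a nonzero prime of `B`, and suppose every class of `B/P` has a representative in
`A` (residue degree one) and the extended ideal `I = (P ∩ A)B` is not contained in `P²`
(ramification index one). Then every `y ∈ B` is congruent modulo `Pⁿ` to an element of `A`, for
every `n`. Proof: `I ⊔ P² = P` (the only ideals between `P²` and `P` being `P²` and `P`,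
`Ideal.eq_prime_pow_of_succ_lt_of_le`); if `B = A + Pⁿ` (as `A`-modules) then
`I = (P ∩ A) • B = (P ∩ A) • A + (P ∩ A) • Pⁿ ⊆ A + P^{n+1}` and
`Pⁿ = P^{n-1}(I ⊔ P²) ⊆ I + P^{n+1} ⊆ A + P^{n+1}`, so `B = A + P^{n+1}`. [folklore] -/
theorem exists_sub_algebraMap_mem_pow (P : Ideal B) [hP : P.IsPrime] (hP0 : P ≠ ⊥)
    (hf : ∀ y : B, ∃ a : A, y - algebraMap A B a ∈ P)
    (he : ¬ (P.under A).map (algebraMap A B) ≤ P ^ 2) (n : ℕ) (y : B) :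
    ∃ a : A, y - algebraMap A B a ∈ P ^ n := by
  set p : Ideal A := P.under A with hp_def
  set I : Ideal B := p.map (algebraMap A B) with hI_def
  set S : Submodule A B := LinearMap.range (Algebra.linearMap A B) with hS_def
  set W : ℕ → Submodule A B := fun k ↦ (P ^ k).restrictScalars A with hW_def
  have hIP : I ≤ P := Ideal.map_le_iff_le_comap.mpr le_rfl
  -- `I ⊔ P² = P`
  have hPeq : I ⊔ P ^ 2 = P := by
    have h := Ideal.eq_prime_pow_of_succ_lt_of_le hP0 (i := 1) (I := I ⊔ P ^ 2) ?_ ?_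
    · rwa [pow_one] at h
    · refine lt_of_le_of_ne le_sup_right fun h ↦ he ?_
      calc I ≤ I ⊔ P ^ 2 := le_sup_left
        _ = P ^ (1 + 1) := h.symm
    · rw [pow_one]
      exact sup_le hIP (Ideal.pow_le_self two_ne_zero)
  -- the claim `S ⊔ W k = ⊤` for `k ≥ 1`, by induction
  have hmemS : ∀ a : A, algebraMap A B a ∈ S := fun a ↦ ⟨a, rfl⟩
  have claim : ∀ k : ℕ, S ⊔ W (k + 1) = ⊤ := by
    intro k
    induction k with
    | zero =>
      refine eq_top_iff.mpr fun z _ ↦ ?_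
      obtain ⟨a, ha⟩ := hf z
      refine Submodule.mem_sup.mpr ⟨algebraMap A B a, hmemS a, z - algebraMap A B a, ?_, by abel⟩
      change z - algebraMap A B a ∈ P ^ (0 + 1)
      rwa [zero_add, pow_one]
    | succ k ih =>
      -- (i) `I ≤ S ⊔ W (k + 2)` as `A`-modules
      have hI : I.restrictScalars A ≤ S ⊔ W (k + 1 + 1) := by
        have h1 : I.restrictScalars A = p • (⊤ : Submodule A B) := (Ideal.smul_top_eq_map p).symm
        rw [h1, ← ih, Submodule.smul_sup]
        refine sup_le ?_ ?_
        · refine le_sup_of_le_left (Submodule.smul_le.mpr fun a _ s hs ↦ ?_)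
          obtain ⟨a', rfl⟩ := hs
          refine ⟨a * a', ?_⟩
          simp [Algebra.smul_def]
        · refine le_sup_of_le_right (Submodule.smul_le.mpr fun a ha z hz ↦ ?_)
          change a • z ∈ P ^ (k + 1 + 1)
          rw [Algebra.smul_def, pow_succ']
          exact Ideal.mul_mem_mul (Ideal.mem_comap.mp ha) hz
      -- (ii) `W (k + 1) ≤ I ⊔ W (k + 2)`
      have hW : W (k + 1) ≤ I.restrictScalars A ⊔ W (k + 1 + 1) := by
        intro z hz
        change z ∈ P ^ (k + 1) at hz
        have hle : P ^ (k + 1) ≤ I ⊔ P ^ (k + 1 + 1) := by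
          calc P ^ (k + 1) = P ^ k * P := pow_succ P k
            _ = P ^ k * (I ⊔ P ^ 2) := by rw [hPeq]
            _ = P ^ k * I ⊔ P ^ k * P ^ 2 := Ideal.mul_sup _ _ _
            _ ≤ I ⊔ P ^ (k + 1 + 1) := by
                refine sup_le_sup Ideal.mul_le_left (le_of_eq ?_)
                rw [← pow_add]
        obtain ⟨i, hi, z', hz', rfl⟩ := Submodule.mem_sup.mp (hle hz)
        exact Submodule.mem_sup.mpr ⟨i, hi, z', hz', rfl⟩
      refine eq_top_iff.mpr ?_
      calc (⊤ : Submodule A B) = S ⊔ W (k + 1) := ih.symm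
        _ ≤ S ⊔ (I.restrictScalars A ⊔ W (k + 1 + 1)) := sup_le_sup_left hW S
        _ ≤ S ⊔ (S ⊔ W (k + 1 + 1) ⊔ W (k + 1 + 1)) := sup_le_sup_left (sup_le_sup_right hI _) S
        _ = S ⊔ W (k + 1 + 1) := by
            rw [sup_assoc S, sup_idem, ← sup_assoc, sup_idem]
  -- conclusion
  rcases n with _ | n
  · exact ⟨0, by rw [pow_zero, Ideal.one_eq_top]; exact Submodule.mem_top⟩
  · have hy : y ∈ S ⊔ W (n + 1) := by rw [claim n]; exact Submodule.mem_top
    obtain ⟨s, ⟨a, rfl⟩, z, hz, hsz⟩ := Submodule.mem_sup.mp hy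
    refine ⟨a, ?_⟩
    have : y - Algebra.linearMap A B a = z := by rw [← hsz]; abel
    rw [Algebra.linearMap_apply] at this
    rw [this]
    exact hz

omit [IsDedekindDomain B] in
/-- Residue degree one, `finrank (A/p) (B/P) = 1`, means that `A → B/P` is onto: every class
of `B/P` is a multiple of `1` by a scalar from the field `A/p`. [folklore] -/
theorem exists_sub_algebraMap_mem_of_finrank_eq_one (p : Ideal A) (P : Ideal B) [p.IsMaximal]
    [P.IsPrime] [P.LiesOver p] (hP : P ≠ ⊤)
    (h : Module.finrank (A ⧸ p) (B ⧸ P) = 1) (y : B) :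
    ∃ a : A, y - algebraMap A B a ∈ P := by
  letI : Field (A ⧸ p) := Ideal.Quotient.field p
  have h1 : (1 : B ⧸ P) ≠ 0 := by
    rw [Ne, ← map_one (Ideal.Quotient.mk P), Ideal.Quotient.eq_zero_iff_mem]
    exact fun h1 ↦ hP (Ideal.eq_top_of_isUnit_mem _ h1 isUnit_one)
  obtain ⟨c, hc⟩ := (finrank_eq_one_iff_of_nonzero' (1 : B ⧸ P) h1).mp h (Ideal.Quotient.mk P y)
  obtain ⟨a, rfl⟩ := Ideal.Quotient.mk_surjective c
  refine ⟨a, ?_⟩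
  rw [← Ideal.Quotient.eq_zero_iff_mem, map_sub, ← hc, Algebra.smul_def, mul_one,
    Ideal.Quotient.algebraMap_mk_of_liesOver, sub_self]

/-- Ramification index one, `e(P|p) = 1` for a nonzero prime `P` of the Dedekind domain `B`
above `p = P ∩ A` with `pB ≠ 0`, means `pB ⊄ P²` (`e` counts `P` in the factorisation of
`pB`). [folklore] -/
theorem not_map_le_sq_of_ramificationIdx'_eq_one (p : Ideal A) (P : Ideal B) [P.IsPrime]
    (hP0 : P ≠ ⊥) (hp0 : p.map (algebraMap A B) ≠ ⊥) (he : Ideal.ramificationIdx' p P = 1) :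
    ¬ p.map (algebraMap A B) ≤ P ^ 2 := by
  classical
  intro hle
  have hPirr := (Ideal.prime_of_isPrime hP0 ‹P.IsPrime›).irreducible
  have hcount : (UniqueFactorizationMonoid.normalizedFactors (p.map (algebraMap A B))).count P =
      1 := by
    rw [← Ideal.IsDedekindDomain.ramificationIdx'_eq_normalizedFactors_count hp0 ‹P.IsPrime› hP0]
    exact he
  have hdvd : P ^ 2 ∣ p.map (algebraMap A B) := Ideal.dvd_iff_le.mpr hle
  rw [UniqueFactorizationMonoid.dvd_iff_normalizedFactors_le_normalizedFactors
      (pow_ne_zero _ hP0) hp0, UniqueFactorizationMonoid.normalizedFactors_pow,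
    UniqueFactorizationMonoid.normalizedFactors_irreducible hPirr, normalize_eq,
    Multiset.nsmul_singleton, ← Multiset.le_count_iff_replicate_le, hcount] at hdvd
  omega

end Algebra

/-! ### Topology: `F_v → K_w` is onto when `e(w|v) = f(w|v) = 1` -/

section NumberField

variable (F K : Type*) [Field F] [NumberField F] [Field K] [NumberField K] [Algebra F K]

/-- **`𝓞_F` is `w`-adically dense in `𝓞_K` at a place of degree one**: if
`e(w|v) = f(w|v) = 1` (`v = w ∩ 𝓞 F`) then every `y ∈ 𝓞_K` is congruent modulo `wⁿ` to some
`a ∈ 𝓞_F`, for every `n` (`exists_sub_algebraMap_mem_pow` with Mathlib's `ramificationIdx` /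
`inertiaDeg`). [folklore] -/
theorem exists_sub_algebraMap_mem_pow_of_ramificationIdx_eq_one_of_inertiaDeg_eq_one
    (w : HeightOneSpectrum (𝓞 K)) (he : w.asIdeal.ramificationIdx (𝓞 F) = 1)
    (hf : w.asIdeal.inertiaDeg (𝓞 F) = 1) (n : ℕ) (y : 𝓞 K) :
    ∃ a : 𝓞 F, y - algebraMap (𝓞 F) (𝓞 K) a ∈ w.asIdeal ^ n := by
  set v : HeightOneSpectrum (𝓞 F) := w.under (𝓞 F) with hv
  haveI : w.asIdeal.LiesOver v.asIdeal := ⟨rfl⟩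
  haveI : v.asIdeal.IsMaximal := v.isMaximal
  haveI : w.asIdeal.IsMaximal := w.isMaximal
  refine exists_sub_algebraMap_mem_pow w.asIdeal w.ne_bot (fun z ↦ ?_) ?_ n y
  · refine exists_sub_algebraMap_mem_of_finrank_eq_one v.asIdeal w.asIdeal
      w.isPrime.ne_top ?_ z
    rw [← Ideal.inertiaDeg'_algebraMap, Ideal.inertiaDeg'_eq_inertiaDeg]
    exact hf
  · change ¬ v.asIdeal.map (algebraMap (𝓞 F) (𝓞 K)) ≤ w.asIdeal ^ 2
    refine not_map_le_sq_of_ramificationIdx'_eq_one v.asIdeal w.asIdeal w.ne_bot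
      (Ideal.map_ne_bot_of_ne_bot v.ne_bot) ?_
    rw [Ideal.ramificationIdx'_eq_ramificationIdx v.asIdeal w.asIdeal v.ne_bot]
    exact he

variable (v : HeightOneSpectrum (𝓞 F)) (w : HeightOneSpectrum (𝓞 K))
  [hw : w.asIdeal.LiesOver v.asIdeal]

/-- The local base-change map `F_v → K_w` preserves valuations at a place with `e(w|v) = 1`
(`valued_adicCompletionOfLiesOver`: `v_w = v_v^{e}` on `F_v`). [folklore] -/
theorem valued_adicCompletionOfLiesOver_of_ramificationIdx_eq_one
    (he : w.asIdeal.ramificationIdx (𝓞 F) = 1) (y : v.adicCompletion F) :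
    Valued.v (adicCompletionOfLiesOver F K v w y) = Valued.v y := by
  have he' : Ideal.ramificationIdx' v.asIdeal w.asIdeal = 1 := by
    rw [Ideal.ramificationIdx'_eq_ramificationIdx v.asIdeal w.asIdeal v.ne_bot]
    exact he
  rw [valued_adicCompletionOfLiesOver, he', pow_one]

/-- The image of `𝓞_K` in `K_w` lies in the closure of the image of `F_v`, at a place of
degree one: `y ∈ 𝓞_K` is the `w`-adic limit of elements of `𝓞_F`
(`exists_sub_algebraMap_mem_pow_…`, `v_w(a - y) ≤ q_w^{-n}`). [folklore] -/
theorem algebraMap_mem_closure_range_adicCompletionOfLiesOver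
    (he : w.asIdeal.ramificationIdx (𝓞 F) = 1) (hf : w.asIdeal.inertiaDeg (𝓞 F) = 1)
    (y : 𝓞 K) :
    algebraMap K (w.adicCompletion K) (y : K) ∈
      closure (Set.range (adicCompletionOfLiesOver F K v w)) := by
  have hvw : w.under (𝓞 F) = v := HeightOneSpectrum.ext hw.over.symm
  rw [mem_closure_iff_nhds]
  intro t ht
  obtain ⟨γ, hγ⟩ := Valued.mem_nhds.mp ht
  -- a natural number `n` with `exp (-n) < γ`
  set emb : MonoidWithZeroHom.ValueGroup₀ (MonoidWithZeroHom.ofClass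
      (Valued.v : Valuation (w.adicCompletion K) (WithZero (Multiplicative ℤ)))) →*₀
        WithZero (Multiplicative ℤ) :=
    MonoidWithZeroHom.ValueGroup₀.embedding with hemb
  set g : WithZero (Multiplicative ℤ) := emb γ.1 with hg_def
  have hg0 : g ≠ 0 := by
    intro h
    apply γ.ne_zero
    apply (MonoidWithZeroHom.ValueGroup₀.embedding_strictMono (f := MonoidWithZeroHom.ofClass
      (Valued.v : Valuation (w.adicCompletion K) (WithZero (Multiplicative ℤ))))).injective
    rw [map_zero]
    exact h
  obtain ⟨n, hn⟩ : ∃ n : ℕ, WithZero.exp (-(n : ℤ)) < g := by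
    refine ⟨(1 - WithZero.log g).toNat, ?_⟩
    conv_rhs => rw [← WithZero.exp_log hg0]
    rw [WithZero.exp_lt_exp]
    omega
  obtain ⟨a, ha⟩ :=
    exists_sub_algebraMap_mem_pow_of_ramificationIdx_eq_one_of_inertiaDeg_eq_one F K w he hf n y
  refine ⟨algebraMap K (w.adicCompletion K) (algebraMap F K (a : F)), hγ ?_,
    ⟨((a : F) : v.adicCompletion F), adicCompletionOfLiesOver_coe F K v w (a : F)⟩⟩
  -- the valuation estimate `v_w (a - y) ≤ exp (-n) < γ`
  simp only [Set.mem_setOf_eq]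
  rw [Valuation.restrict_lt_iff_lt_embedding]
  change _ < g
  refine lt_of_le_of_lt ?_ hn
  set d : 𝓞 K := algebraMap (𝓞 F) (𝓞 K) a - y with hd
  have hmem : d ∈ w.asIdeal ^ n := by
    rw [hd, ← neg_sub]
    exact neg_mem ha
  have hcoe : algebraMap K (w.adicCompletion K) (algebraMap F K (a : F)) -
      algebraMap K (w.adicCompletion K) (y : K) =
        algebraMap K (w.adicCompletion K) (algebraMap (𝓞 K) K d) := by
    rw [hd, map_sub (algebraMap (𝓞 K) K), ← IsScalarTower.algebraMap_apply (𝓞 F) (𝓞 K) K,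
      IsScalarTower.algebraMap_apply (𝓞 F) F K, map_sub]
  rw [hcoe]
  change Valued.v ((algebraMap (𝓞 K) K d : K) : w.adicCompletion K) ≤ _
  rw [HeightOneSpectrum.valuedAdicCompletion_eq_valuation',
    HeightOneSpectrum.valuation_of_algebraMap]
  exact (w.intValuation_le_pow_iff_mem d n).mpr hmem

open scoped Valued in
/-- **`F_v → K_w` is onto at a place of degree one** (`e(w|v) = f(w|v) = 1`): its image is an
`F_v`-line in the Hausdorff topological `F_v`-vector space `K_w`, hence closed
(`Submodule.closed_of_finiteDimensional`), and it contains the dense image of `K`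
(`algebraMap_mem_closure_range_adicCompletionOfLiesOver` for `𝓞_K`, fractions for `K`). This
is the case `[K_w : F_v] = e f = 1` of the local degree formula. (`open scoped Valued` supplies
the scoped instance `Valued.toNontriviallyNormedField` on `F_v`.) [folklore] -/
theorem surjective_adicCompletionOfLiesOver
    (he : w.asIdeal.ramificationIdx (𝓞 F) = 1) (hf : w.asIdeal.inertiaDeg (𝓞 F) = 1) :
    Function.Surjective (adicCompletionOfLiesOver F K v w) := by
  set ι := adicCompletionOfLiesOver F K v w with hι
  letI : Algebra (v.adicCompletion F) (w.adicCompletion K) := ι.toAlgebra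
  haveI : ContinuousSMul (v.adicCompletion F) (w.adicCompletion K) :=
    ⟨((continuous_adicCompletionOfLiesOver F K v w).comp continuous_fst).mul continuous_snd⟩
  -- the range of `ι` is the `F_v`-span of `1`, a closed subspace
  set S : Submodule (v.adicCompletion F) (w.adicCompletion K) :=
    Submodule.span (v.adicCompletion F) {(1 : w.adicCompletion K)} with hS
  have hrange : Set.range ι = (S : Set (w.adicCompletion K)) := by
    ext z
    simp only [Set.mem_range, SetLike.mem_coe, hS, Submodule.mem_span_singleton]
    constructor
    · rintro ⟨y, rfl⟩
      exact ⟨y, by rw [Algebra.smul_def, mul_one]; rfl⟩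
    · rintro ⟨y, rfl⟩
      exact ⟨y, by rw [Algebra.smul_def, mul_one]; rfl⟩
  have hclosed : IsClosed (Set.range ι) := by
    rw [hrange]
    exact Submodule.closed_of_finiteDimensional (𝕜 := v.adicCompletion F)
      (E := w.adicCompletion K) S
  -- it contains the image of `K`
  have hO : ∀ y : 𝓞 K, algebraMap K (w.adicCompletion K) (y : K) ∈ Set.range ι := fun y ↦ by
    rw [← hclosed.closure_eq]
    exact algebraMap_mem_closure_range_adicCompletionOfLiesOver F K v w he hf y
  have hK : ∀ k : K, algebraMap K (w.adicCompletion K) k ∈ Set.range ι := by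
    intro k
    obtain ⟨b, c, hc, rfl⟩ := IsFractionRing.div_surjective (A := 𝓞 K) k
    have hmem : algebraMap K (w.adicCompletion K) (algebraMap (𝓞 K) K b / algebraMap (𝓞 K) K c) ∈
        ι.fieldRange := by
      rw [map_div₀]
      exact div_mem (ι.mem_fieldRange.mpr (hO b)) (ι.mem_fieldRange.mpr (hO c))
    exact ι.mem_fieldRange.mp hmem
  -- hence it is dense, and closed, so everything
  have hdense : Dense (Set.range ι) :=
    (w.denseRange_algebraMap (K := K)).mono (Set.range_subset_iff.mpr hK)
  intro z
  have hz : z ∈ Set.range ι := by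
    rw [← hclosed.closure_eq, hdense.closure_eq]
    exact Set.mem_univ z
  exact hz

/-- **The completion at a place of degree one is the completion below**: for an extension of
number fields `K/F` and a finite place `w ∣ v` with `e(w|v) = f(w|v) = 1` there are compatible
ring isomorphisms `ψ : 𝒪_v ≃+* 𝒪_w`, `φ : F_v ≃+* K_w` (`φ ∘ algebraMap = algebraMap ∘ ψ`) with
`φ` extending `F → K` — the local degree formula `[K_w : F_v] = e f` in degree one
(Cassels–Fröhlich, Ch. II §10). Stated as an existence theorem in the hypothesis form of the
transport lemmas `WeierstrassCurve.localEulerFactor_map_ringEquiv`,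
`WeierstrassCurve.localRootNumber_map_ringEquiv`. [folklore] -/
theorem exists_ringEquiv_adicCompletion_of_ramificationIdx_eq_one_of_inertiaDeg_eq_one
    (he : w.asIdeal.ramificationIdx (𝓞 F) = 1) (hf : w.asIdeal.inertiaDeg (𝓞 F) = 1) :
    ∃ (ψ : v.adicCompletionIntegers F ≃+* w.adicCompletionIntegers K)
      (φ : v.adicCompletion F ≃+* w.adicCompletion K),
      (∀ r : v.adicCompletionIntegers F,
          φ (algebraMap (v.adicCompletionIntegers F) (v.adicCompletion F) r) =
            algebraMap (w.adicCompletionIntegers K) (w.adicCompletion K) (ψ r)) ∧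
        ∀ x : F, φ ((x : v.adicCompletion F)) = ((algebraMap F K x : K) : w.adicCompletion K) := by
  set ι := adicCompletionOfLiesOver F K v w with hι
  have hval := valued_adicCompletionOfLiesOver_of_ramificationIdx_eq_one F K v w he
  have hbij : Function.Bijective ι :=
    ⟨ι.injective, surjective_adicCompletionOfLiesOver F K v w he hf⟩
  -- the restriction to the valuation rings
  have hint : ∀ x ∈ v.adicCompletionIntegers F, ι x ∈ w.adicCompletionIntegers K := fun x hx ↦ by
    rw [HeightOneSpectrum.mem_adicCompletionIntegers] at hx ⊢
    rwa [hval]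
  set ψ₀ : v.adicCompletionIntegers F →+* w.adicCompletionIntegers K :=
    ι.restrict (v.adicCompletionIntegers F) (w.adicCompletionIntegers K) hint with hψ₀_def
  have hψ₀ : Function.Bijective ψ₀ := by
    refine ⟨fun x y hxy ↦ Subtype.ext (ι.injective (congrArg Subtype.val hxy)), fun z ↦ ?_⟩
    obtain ⟨x, hx⟩ := hbij.2 (z : w.adicCompletion K)
    have hxint : x ∈ v.adicCompletionIntegers F := by
      rw [HeightOneSpectrum.mem_adicCompletionIntegers, ← hval, hx]
      exact z.2
    exact ⟨⟨x, hxint⟩, Subtype.ext hx⟩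
  exact ⟨RingEquiv.ofBijective ψ₀ hψ₀, RingEquiv.ofBijective ι hbij, fun r ↦ rfl,
    fun x ↦ adicCompletionOfLiesOver_coe F K v w x⟩

end NumberField

end Literature.NumberTheory.Automorphic

end
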